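import Literature.AlgebraicGeometry.ShimuraVarieties.UnitaryCurveConeSliceRegularity
import HarnessLib

/-!
# The cotangent MODULUS on the cone-open of `GL₂(ℂ)`: `|λ(u⁻¹ g)| = |det g| · ⟪v₀,v₀⟫ ∕ ⟪g v₀, g v₀⟫`, and the
# local uniform bound it gives for cone-holomorphic functions bounded on `U(σ_{w₁}J)(ℂ)`

Topic `AlgebraicGeometry/ShimuraVarieties`; namespace `Literature.AlgebraicGeometry.ShimuraVarieties.UnitaryCurveCone` (sequel of ★
`UnitaryCurveConeExtension`, whose §4 factorisation `Ω = U · Stab(ℂ v₀)` and §1–§3 frame algebra are used, and of ★ `UnitaryCurveConeSliceRegularity`,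
whose `isOpen_coneOpen` is reused).  THEOREMS ONLY (no `def`,
no instance, no notation, no named fact, no `sorry`).

SETTING as there: `J ∈ M₂(E)`, a complex place `w₁`, `Jw := σ_{w₁} J` HERMITIAN, a cone frame `𝔣 = (v₀, t₀)` (★ `ConeFrame`),
`U := archLocal E 2 J w₁ = U(Jw)`, the cone-open `Ω = {g | IsUnit g ∧ g v₀ ∈ negCone Jw}` and the cone law of ★ `IsConeHol`
(`Φ (g b) = (a k⁻¹) Φ g` for `b v₀ = k v₀`, `b t₀ = a t₀ + d v₀`).

RESULTS.
* §1 `det_eq_of_frame_coords` — a matrix stabilising the line `ℂ v₀` with frame coordinates `(k, a, d)` has `det b = a k` (it is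
  triangular in the basis `(t₀, v₀)`); `norm_det_coe_archLocal` — `|det u| = 1` on `U` (`uᴴ Jw u = Jw`, `det Jw ≠ 0`);
  `form_self_of_factorisation` — `⟪g v₀, g v₀⟫ = |k|² ⟪v₀, v₀⟫` for `g = u b`.
* §2 **`norm_coneChar_eq`** — for ANY factorisation `g = u b` of a point of `Ω`: `|a k⁻¹| = |det g| · (⟪v₀,v₀⟫.re ∕ ⟪g v₀, g v₀⟫.re)`
  — the COTANGENT MODULUS is factorisation-independent and a continuous function of `g` on `Ω`;
  **`norm_apply_le_of_isConeHol`** — a cone-holomorphic `Φ` with `|Φ| ≤ C` on `U` satisfies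
  `|Φ g| ≤ |det g| · (⟪v₀,v₀⟫.re ∕ ⟪g v₀, g v₀⟫.re) · C` on `Ω`.
* §3 **`exists_ball_norm_apply_le`** — LOCAL UNIFORM BOUND: every point of `Ω` (read in `ℂ^{2×2} = Fin 2 → Fin 2 → ℂ`) has a ball on
  which `|Φ| ≤ M · C` for ALL cone-holomorphic `Φ` bounded by `C` on `U`, `M` depending on the point only.  This is the local
  boundedness input of Montel's theorem ∕ Cauchy's estimates (★ `Literature/Analysis/Complex/MontelSCV`) for families of slices of
  automorphic forms bounded on the group ([Borel1997, §5.14]: a form on `SL₂(ℝ)` of weight `m` is `f(g) = F(g·i) j(g,i)^{-m}`, so a sup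
  bound on the group is a weighted sup bound on the half-plane; here frame-free on the cone over the disc of negative lines).
Cell `hodgecm-mathlib`, floor 0, K-lane of the P5 named fact E₂ (cut S3₂ «admissibility of a `σ` realised in cone-holomorphic forms»,
F0P5-p02 (g2) census `CENSUS-KE2-cohIsotypicLine2`); seat F0P5-p04 (g2).  HC_CM is proved only modulo the printed citations until rung 0
closes; nothing printed is asserted here.

## References
* [Borel1997] A. Borel, *Automorphic forms on SL₂(ℝ)*, Cambridge Tracts in Math. 130 (1997), §5.13–§5.14 (automorphy factor,
  functions on the group vs. on the upper half plane; boundedness of cusp forms §5.15 is NOT used — compact-quotient case only).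
* [BergeronMillsonMoeglin2016Balls] N. Bergeron, J. Millson, C. Moeglin, Acta Math. 216 (2016), Part 2 §1.3 (negative lines).
* [Jacobson] N. Jacobson, *Basic Algebra I*, 2nd ed. (1985), Ch. V §7, §11 (frames, Witt's theorem).
-/

set_option autoImplicit false

noncomputable section

open Matrix NumberField NumberField.InfinitePlace Metric
open scoped Matrix ComplexConjugate ComplexOrder
open Literature.NumberTheory.Automorphic Literature.NumberTheory.Automorphic.UnitaryGroup
open Literature.NumberTheory.Automorphic.UnitaryCurveForms

namespace Literature.AlgebraicGeometry.ShimuraVarieties.UnitaryCurveCone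

variable {E : Type} [Field E] {J : Matrix (Fin 2) (Fin 2) E} {w₁ : {w : InfinitePlace E // IsComplex w}} (𝔣 : ConeFrame E J w₁)

/-! ### §1. Determinants: `det b = a k` on `Stab(ℂ v₀)`, `|det u| = 1` on `U`, `⟪g v₀, g v₀⟫ = |k|² ⟪v₀, v₀⟫` -/

/-- **`det b = a k`** for `b v₀ = k v₀`, `b t₀ = a t₀ + d v₀`: in the basis `(t₀, v₀)` of `ℂ²` the matrix of `b` is `(a 0; d k)`.
[cite: Jacobson, Ch. V §7 pp. 150–151] -/
theorem det_eq_of_frame_coords (hJ : (J.map w₁.1.embedding).IsHermitian) {b : Matrix (Fin 2) (Fin 2) ℂ} {k a d : ℂ}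
    (hbv : b *ᵥ 𝔣.v₀ = k • 𝔣.v₀) (hbt : b *ᵥ 𝔣.t₀ = a • 𝔣.t₀ + d • 𝔣.v₀) : b.det = a * k := by
  have hli := linearIndependent_frame 𝔣 hJ
  have hcard : Fintype.card (Fin 2) = Module.finrank ℂ (Fin 2 → ℂ) := by simp
  let B := basisOfLinearIndependentOfCardEqFinrank hli hcard
  have hB0 : B 0 = 𝔣.t₀ := by simp [B]
  have hB1 : B 1 = 𝔣.v₀ := by simp [B]
  have h0 : Matrix.toLin' b (B 0) = a • B 0 + d • B 1 := by rw [Matrix.toLin'_apply, hB0, hB1, hbt]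
  have h1 : Matrix.toLin' b (B 1) = k • B 1 := by rw [Matrix.toLin'_apply, hB1, hbv]
  rw [← LinearMap.det_toLin' b, ← LinearMap.det_toMatrix B, Matrix.det_fin_two]
  have e00 : LinearMap.toMatrix B B (Matrix.toLin' b) 0 0 = a := by
    rw [LinearMap.toMatrix_apply, h0, map_add, map_smul, map_smul, B.repr_self, B.repr_self]; simp
  have e11 : LinearMap.toMatrix B B (Matrix.toLin' b) 1 1 = k := by
    rw [LinearMap.toMatrix_apply, h1, map_smul, B.repr_self]; simp
  have e01 : LinearMap.toMatrix B B (Matrix.toLin' b) 0 1 = 0 := by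
    rw [LinearMap.toMatrix_apply, h1, map_smul, B.repr_self]; simp
  rw [e00, e11, e01, zero_mul, sub_zero]

include 𝔣 in
/-- **`|det u| = 1` for `u ∈ U(Jw)`**: `uᴴ Jw u = Jw` and `det Jw ≠ 0` give `conj (det u) · det u = 1`. [cite: Jacobson, Ch. V §11 p. 162] -/
theorem norm_det_coe_archLocal (hJ : (J.map w₁.1.embedding).IsHermitian) (u : archLocal E 2 J w₁) :
    ‖((u : GL (Fin 2) ℂ) : Matrix (Fin 2) (Fin 2) ℂ).det‖ = 1 := by
  have hu := (mem_archLocal_iff_conjTranspose E 2 J w₁ (u : GL (Fin 2) ℂ)).1 u.2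
  have hJdet : (J.map w₁.1.embedding).det ≠ 0 := by
    have h := isUnit_form 𝔣 hJ
    rw [Matrix.isUnit_iff_isUnit_det, isUnit_iff_ne_zero] at h
    exact h
  have h := congrArg Matrix.det hu
  rw [Matrix.det_mul, Matrix.det_mul, Matrix.det_conjTranspose] at h
  -- `star (det u) * det Jw * det u = det Jw` ⇒ `star (det u) * det u = 1`
  have h1 : star ((u : GL (Fin 2) ℂ) : Matrix (Fin 2) (Fin 2) ℂ).det * ((u : GL (Fin 2) ℂ) : Matrix (Fin 2) (Fin 2) ℂ).det = 1 := by
    have h' : (star ((u : GL (Fin 2) ℂ) : Matrix (Fin 2) (Fin 2) ℂ).det * ((u : GL (Fin 2) ℂ) : Matrix (Fin 2) (Fin 2) ℂ).det) *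
        (J.map w₁.1.embedding).det = 1 * (J.map w₁.1.embedding).det :=
      calc (star ((u : GL (Fin 2) ℂ) : Matrix (Fin 2) (Fin 2) ℂ).det * ((u : GL (Fin 2) ℂ) : Matrix (Fin 2) (Fin 2) ℂ).det) *
            (J.map w₁.1.embedding).det
          = star ((u : GL (Fin 2) ℂ) : Matrix (Fin 2) (Fin 2) ℂ).det * (J.map w₁.1.embedding).det *
            ((u : GL (Fin 2) ℂ) : Matrix (Fin 2) (Fin 2) ℂ).det := by ring
        _ = (J.map w₁.1.embedding).det := h
        _ = 1 * (J.map w₁.1.embedding).det := (one_mul _).symm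
    exact mul_right_cancel₀ hJdet h'
  have h2 : ‖((u : GL (Fin 2) ℂ) : Matrix (Fin 2) (Fin 2) ℂ).det‖ ^ 2 = 1 := by
    have h3 := congrArg (fun z : ℂ => ‖z‖) h1
    simp only [norm_mul, norm_one, Complex.star_def, Complex.norm_conj] at h3
    nlinarith [h3]
  have hn : 0 ≤ ‖((u : GL (Fin 2) ℂ) : Matrix (Fin 2) (Fin 2) ℂ).det‖ := norm_nonneg _
  nlinarith [h2, hn]

/-- **`⟪g v₀, g v₀⟫ = (k̄ k) ⟪v₀, v₀⟫`** for `g = u b`, `u ∈ U`, `b v₀ = k v₀` (`u` preserves the form, ★ `form_mulVec_mulVec`).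
[cite: Jacobson, Ch. V §11 p. 162] -/
theorem form_self_of_factorisation (u : archLocal E 2 J w₁) {b g : Matrix (Fin 2) (Fin 2) ℂ} {k : ℂ}
    (hgb : g = ((u : GL (Fin 2) ℂ) : Matrix (Fin 2) (Fin 2) ℂ) * b) (hbv : b *ᵥ 𝔣.v₀ = k • 𝔣.v₀) :
    star (g *ᵥ 𝔣.v₀) ⬝ᵥ (J.map w₁.1.embedding *ᵥ (g *ᵥ 𝔣.v₀)) =
      (starRingEnd ℂ k * k) * (star 𝔣.v₀ ⬝ᵥ (J.map w₁.1.embedding *ᵥ 𝔣.v₀)) := by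
  have hgv : g *ᵥ 𝔣.v₀ = ((u : GL (Fin 2) ℂ) : Matrix (Fin 2) (Fin 2) ℂ) *ᵥ (k • 𝔣.v₀) := by
    rw [hgb, ← mulVec_mulVec, hbv]
  rw [hgv, form_mulVec_mulVec, star_smul, mulVec_smul, dotProduct_smul, smul_dotProduct, smul_eq_mul, smul_eq_mul,
    Complex.star_def]
  ring

/-! ### §2. The cotangent modulus and the pointwise bound on `Ω` -/

/-- **THE COTANGENT MODULUS IS FACTORISATION-INDEPENDENT**: if `g = u b` with `u ∈ U(Jw)` and `b v₀ = k v₀`, `b t₀ = a t₀ + d v₀`, `k ≠ 0`,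
then `|a k⁻¹| = |det g| · (⟪v₀,v₀⟫.re ∕ ⟪g v₀, g v₀⟫.re)` (`|a k| = |det b| = |det g|`, `|k|² = ⟪g v₀,g v₀⟫ ∕ ⟪v₀,v₀⟫`).
[cite: Borel1997, §5.13–§5.14] -/
theorem norm_coneChar_eq (hJ : (J.map w₁.1.embedding).IsHermitian) (u : archLocal E 2 J w₁) {b g : Matrix (Fin 2) (Fin 2) ℂ}
    {k a d : ℂ} (hgb : g = ((u : GL (Fin 2) ℂ) : Matrix (Fin 2) (Fin 2) ℂ) * b) (hk : k ≠ 0) (hbv : b *ᵥ 𝔣.v₀ = k • 𝔣.v₀)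
    (hbt : b *ᵥ 𝔣.t₀ = a • 𝔣.t₀ + d • 𝔣.v₀) :
    ‖a * k⁻¹‖ = ‖g.det‖ * ((star 𝔣.v₀ ⬝ᵥ (J.map w₁.1.embedding *ᵥ 𝔣.v₀)).re /
      (star (g *ᵥ 𝔣.v₀) ⬝ᵥ (J.map w₁.1.embedding *ᵥ (g *ᵥ 𝔣.v₀))).re) := by
  have hν : (star 𝔣.v₀ ⬝ᵥ (J.map w₁.1.embedding *ᵥ 𝔣.v₀)).re ≠ 0 := (mem_negCone_iff.1 𝔣.v₀_mem).ne
  have hdet : ‖g.det‖ = ‖a‖ * ‖k‖ := by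
    rw [hgb, Matrix.det_mul, norm_mul, norm_det_coe_archLocal 𝔣 hJ u, one_mul, det_eq_of_frame_coords 𝔣 hJ hbv hbt, norm_mul]
  have hform : (star (g *ᵥ 𝔣.v₀) ⬝ᵥ (J.map w₁.1.embedding *ᵥ (g *ᵥ 𝔣.v₀))).re =
      ‖k‖ ^ 2 * (star 𝔣.v₀ ⬝ᵥ (J.map w₁.1.embedding *ᵥ 𝔣.v₀)).re := by
    rw [form_self_of_factorisation 𝔣 u hgb hbv, ← Complex.normSq_eq_conj_mul_self, Complex.re_ofReal_mul, Complex.normSq_eq_norm_sq]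
  have hk' : ‖k‖ ≠ 0 := norm_ne_zero_iff.2 hk
  rw [hdet, hform, norm_mul, norm_inv]
  field_simp

/-- **POINTWISE BOUND ON THE CONE-OPEN**: a cone-holomorphic `Φ` (★ `IsConeHol 𝔣 Φ`) with `|Φ u| ≤ C` for all `u ∈ U(Jw)` satisfies
`|Φ g| ≤ |det g| · (⟪v₀,v₀⟫.re ∕ ⟪g v₀, g v₀⟫.re) · C` at every `g ∈ Ω` (factorise `g = u b`, ★ `exists_factorisation`, and apply the
cone law). [cite: Borel1997, §5.13–§5.14] -/
theorem norm_apply_le_of_isConeHol (hJ : (J.map w₁.1.embedding).IsHermitian) {Φ : Matrix (Fin 2) (Fin 2) ℂ → ℂ}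
    (hΦ : IsConeHol 𝔣 Φ) {C : ℝ} (hC : ∀ u : archLocal E 2 J w₁, ‖Φ ((u : GL (Fin 2) ℂ) : Matrix (Fin 2) (Fin 2) ℂ)‖ ≤ C)
    {g : Matrix (Fin 2) (Fin 2) ℂ} (hg : IsUnit g) (hgv : g *ᵥ 𝔣.v₀ ∈ negCone (J.map w₁.1.embedding)) :
    ‖Φ g‖ ≤ ‖g.det‖ * ((star 𝔣.v₀ ⬝ᵥ (J.map w₁.1.embedding *ᵥ 𝔣.v₀)).re /
      (star (g *ᵥ 𝔣.v₀) ⬝ᵥ (J.map w₁.1.embedding *ᵥ (g *ᵥ 𝔣.v₀))).re) * C := by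
  obtain ⟨⟨u, b, k, a, d⟩, hgb, hk, -, hbv, hbt⟩ := exists_factorisation 𝔣 hJ hg hgv
  dsimp only at hgb hk hbv hbt
  obtain ⟨huu, huv⟩ := isUnit_and_mulVec_mem_negCone 𝔣 u
  have hlaw := hΦ.2 _ b a k d huu huv hk hbv hbt
  rw [← hgb] at hlaw
  rw [hlaw, norm_mul, norm_coneChar_eq 𝔣 hJ u hgb hk hbv hbt]
  have h0 : 0 ≤ ‖g.det‖ * ((star 𝔣.v₀ ⬝ᵥ (J.map w₁.1.embedding *ᵥ 𝔣.v₀)).re /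
      (star (g *ᵥ 𝔣.v₀) ⬝ᵥ (J.map w₁.1.embedding *ᵥ (g *ᵥ 𝔣.v₀))).re) := by
    rw [← norm_coneChar_eq 𝔣 hJ u hgb hk hbv hbt]; exact norm_nonneg _
  exact mul_le_mul_of_nonneg_left (hC u) h0

/-! ### §3. The local uniform bound on `Ω` (input of Montel ∕ Cauchy estimates for bounded families of slices) -/

/-- The modulus weight `m ↦ |det m| · ⟪v₀,v₀⟫.re ∕ ⟪m v₀, m v₀⟫.re` is continuous at every point of the cone-open.
[cite: Borel1997, §5.13–§5.14] -/
theorem continuousAt_modulusWeight {g₀ : Fin 2 → Fin 2 → ℂ}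
    (hg₀ : Matrix.of g₀ *ᵥ 𝔣.v₀ ∈ negCone (J.map w₁.1.embedding)) :
    ContinuousAt (fun m : Fin 2 → Fin 2 → ℂ => ‖(Matrix.of m).det‖ * ((star 𝔣.v₀ ⬝ᵥ (J.map w₁.1.embedding *ᵥ 𝔣.v₀)).re /
      (star (Matrix.of m *ᵥ 𝔣.v₀) ⬝ᵥ (J.map w₁.1.embedding *ᵥ (Matrix.of m *ᵥ 𝔣.v₀))).re)) g₀ := by
  have hid : Continuous fun m : Fin 2 → Fin 2 → ℂ => Matrix.of m := continuous_id
  have hdet : Continuous fun m : Fin 2 → Fin 2 → ℂ => ‖(Matrix.of m).det‖ := hid.matrix_det.norm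
  have hmv : Continuous fun m : Fin 2 → Fin 2 → ℂ => Matrix.of m *ᵥ 𝔣.v₀ := hid.matrix_mulVec continuous_const
  have hden : Continuous fun m : Fin 2 → Fin 2 → ℂ =>
      (star (Matrix.of m *ᵥ 𝔣.v₀) ⬝ᵥ (J.map w₁.1.embedding *ᵥ (Matrix.of m *ᵥ 𝔣.v₀))).re :=
    Complex.continuous_re.comp ((hmv.star).dotProduct (continuous_const.matrix_mulVec hmv))
  have hne : (star (Matrix.of g₀ *ᵥ 𝔣.v₀) ⬝ᵥ (J.map w₁.1.embedding *ᵥ (Matrix.of g₀ *ᵥ 𝔣.v₀))).re ≠ 0 :=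
    (mem_negCone_iff.1 hg₀).ne
  exact hdet.continuousAt.mul ((continuous_const.continuousAt).div hden.continuousAt hne)

/-- **LOCAL UNIFORM BOUND.**  Around every point `g₀` of the cone-open there is a ball `B(g₀, r)` and a constant `M` such that
EVERY cone-holomorphic `Φ` (★ `IsConeHol 𝔣 Φ`) with `|Φ| ≤ C` on `U(Jw)` satisfies `|Φ m| ≤ M · C` for `m ∈ B(g₀, r) ∩ Ω` — the
family of such `Φ` is locally bounded on `Ω`, uniformly in the group bound `C` ([Borel1997, §5.14]: weighted sup bounds; the weight is
the continuous cotangent modulus of §2). [cite: Borel1997, §5.13–§5.14] -/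
theorem exists_ball_norm_apply_le (hJ : (J.map w₁.1.embedding).IsHermitian) {g₀ : Fin 2 → Fin 2 → ℂ}
    (hg₀ : IsUnit (Matrix.of g₀) ∧ Matrix.of g₀ *ᵥ 𝔣.v₀ ∈ negCone (J.map w₁.1.embedding)) :
    ∃ M : ℝ, ∃ r > 0, ∀ (Φ : Matrix (Fin 2) (Fin 2) ℂ → ℂ), IsConeHol 𝔣 Φ → ∀ C : ℝ,
      (∀ u : archLocal E 2 J w₁, ‖Φ ((u : GL (Fin 2) ℂ) : Matrix (Fin 2) (Fin 2) ℂ)‖ ≤ C) →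
      ∀ m ∈ ball g₀ r, IsUnit (Matrix.of m) ∧ Matrix.of m *ᵥ 𝔣.v₀ ∈ negCone (J.map w₁.1.embedding) →
        ‖Φ (Matrix.of m)‖ ≤ M * C := by
  set β : (Fin 2 → Fin 2 → ℂ) → ℝ := fun m => ‖(Matrix.of m).det‖ * ((star 𝔣.v₀ ⬝ᵥ (J.map w₁.1.embedding *ᵥ 𝔣.v₀)).re /
      (star (Matrix.of m *ᵥ 𝔣.v₀) ⬝ᵥ (J.map w₁.1.embedding *ᵥ (Matrix.of m *ᵥ 𝔣.v₀))).re) with hβ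
  have hcont : ContinuousAt β g₀ := continuousAt_modulusWeight 𝔣 hg₀.2
  obtain ⟨r, hr, hball⟩ := Metric.continuousAt_iff.1 hcont 1 one_pos
  refine ⟨β g₀ + 1, r, hr, fun Φ hΦ C hC m hm hmΩ => ?_⟩
  have hC0 : 0 ≤ C := (norm_nonneg _).trans (hC 1)
  have h1 : ‖Φ (Matrix.of m)‖ ≤ β m * C := norm_apply_le_of_isConeHol 𝔣 hJ hΦ hC hmΩ.1 hmΩ.2
  have h2 : β m ≤ β g₀ + 1 := by
    have h := hball hm
    rw [Real.dist_eq] at h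
    linarith [(abs_lt.1 h).2]
  exact h1.trans (mul_le_mul_of_nonneg_right h2 hC0)


/-! ### §4. Packaged forms for families (the hypotheses of ★ `MontelSCV` verbatim) -/

/-- Points of `U(Jw)` lie in the cone-open (read in `ℂ^{2×2}`). [cite: BergeronMillsonMoeglin2016Balls, Part 2 §1.3] -/
theorem coe_archLocal_mem_coneOpen (u : archLocal E 2 J w₁) :
    (fun i j => ((u : GL (Fin 2) ℂ) : Matrix (Fin 2) (Fin 2) ℂ) i j) ∈
      {m : Fin 2 → Fin 2 → ℂ | IsUnit (Matrix.of m) ∧ Matrix.of m *ᵥ 𝔣.v₀ ∈ negCone (J.map w₁.1.embedding)} :=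
  isUnit_and_mulVec_mem_negCone 𝔣 u

/-- An invertible matrix moving `v₀` into the negative cone lies in the cone-open (read in `ℂ^{2×2}`).
[cite: BergeronMillsonMoeglin2016Balls, Part 2 §1.3] -/
theorem mem_coneOpen_of_isUnit {g : Matrix (Fin 2) (Fin 2) ℂ} (hg : IsUnit g) (hgv : g *ᵥ 𝔣.v₀ ∈ negCone (J.map w₁.1.embedding)) :
    (fun i j => g i j) ∈ {m : Fin 2 → Fin 2 → ℂ | IsUnit (Matrix.of m) ∧ Matrix.of m *ᵥ 𝔣.v₀ ∈ negCone (J.map w₁.1.embedding)} :=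
  ⟨hg, hgv⟩

/-- Conversely a point of the cone-open is an invertible matrix moving `v₀` into the negative cone. [cite: BergeronMillsonMoeglin2016Balls, Part 2 §1.3] -/
theorem isUnit_of_mem_coneOpen {m : Fin 2 → Fin 2 → ℂ}
    (hm : m ∈ {m : Fin 2 → Fin 2 → ℂ | IsUnit (Matrix.of m) ∧ Matrix.of m *ᵥ 𝔣.v₀ ∈ negCone (J.map w₁.1.embedding)}) :
    IsUnit (Matrix.of m) ∧ Matrix.of m *ᵥ 𝔣.v₀ ∈ negCone (J.map w₁.1.embedding) :=
  hm

/-- A family of cone-holomorphic functions is complex-differentiable on the cone-open (first clause of ★ `IsConeHol`, packaged for families).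
[cite: Borel1997, §5.13–§5.14] -/
theorem differentiableOn_family {ι : Type*} (Φ : ι → Matrix (Fin 2) (Fin 2) ℂ → ℂ) (hΦ : ∀ i, IsConeHol 𝔣 (Φ i)) (i : ι) :
    DifferentiableOn ℂ (fun m : Fin 2 → Fin 2 → ℂ => Φ i (Matrix.of m))
      {m : Fin 2 → Fin 2 → ℂ | IsUnit (Matrix.of m) ∧ Matrix.of m *ᵥ 𝔣.v₀ ∈ negCone (J.map w₁.1.embedding)} :=
  (hΦ i).1

/-- **A family of cone-holomorphic functions bounded by `1` on `U(Jw)` is LOCALLY BOUNDED on the cone-open** — the hypothesis `hb` of ★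
`SCV.exists_strictMono_tendstoLocallyUniformlyOn` ∕ ★ `SCV.exists_ball_norm_sub_le_of_locally_bounded` verbatim. [cite: Borel1997, §5.13–§5.14] -/
theorem locallyBounded_family (hJ : (J.map w₁.1.embedding).IsHermitian) {ι : Type*} (Φ : ι → Matrix (Fin 2) (Fin 2) ℂ → ℂ)
    (hΦ : ∀ i, IsConeHol 𝔣 (Φ i)) (h1 : ∀ i (u : archLocal E 2 J w₁), ‖Φ i ((u : GL (Fin 2) ℂ) : Matrix (Fin 2) (Fin 2) ℂ)‖ ≤ 1) :
    ∀ a ∈ {m : Fin 2 → Fin 2 → ℂ | IsUnit (Matrix.of m) ∧ Matrix.of m *ᵥ 𝔣.v₀ ∈ negCone (J.map w₁.1.embedding)},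
      ∃ M : ℝ, ∃ r > 0, ∀ i, ∀ z ∈ ball a r ∩
        {m : Fin 2 → Fin 2 → ℂ | IsUnit (Matrix.of m) ∧ Matrix.of m *ᵥ 𝔣.v₀ ∈ negCone (J.map w₁.1.embedding)},
        ‖(fun m : Fin 2 → Fin 2 → ℂ => Φ i (Matrix.of m)) z‖ ≤ M := by
  intro a ha
  obtain ⟨M, r, hr, hM⟩ := exists_ball_norm_apply_le 𝔣 hJ ha
  exact ⟨M * 1, r, hr, fun i z hz => hM (Φ i) (hΦ i) 1 (h1 i) z hz.1 hz.2⟩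

end Literature.AlgebraicGeometry.ShimuraVarieties.UnitaryCurveCone

end
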